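import Summits.Ventures.PercRepro.Night2LocalD2OnePair
import Summits.Ventures.PercRepro.Night2LocalD2FarPairs

/-!
# PercRepro — the (6,4) cell `|E ∖ G| = 2` with at most two 2-cocircuit hyperplanes (night-2, gen 14)

`localShadowHall_d2_of_one_pair` (Night2LocalD2OnePair) allows one closure among the members with `|G ∖ cl B| = 2`.
With `coverPreimages_eq_empty_of_two_far` (Night2LocalD2FarPairs) the pair-5 rule also certifies the flats where
these members have at most TWO distinct closures (`M|G` has at most two 2-cocircuits carrying members):

**`localShadowHall_d2_of_two_pair`** — `G ∈ flatsQ M 5`, `|E ∖ G| = 2`, every member below `G` has `|G ∖ cl B| ≥ 2`,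
and the closures of the members with `|G ∖ cl B| = 2` take at most two values ⟹ `LocalShadowHall M 4 G`.

Columns: a shadow set `S` has `f := #opFarPre S ≤ 2` far preimages (distinct far preimages have distinct closures,
`card_opFarPre_le_two`).  If `f ≤ 1` the column is bounded as in `sum_opW_col_le` (`5κ₀ + P + 4f ≤ 25`); if `f = 2`
the two far preimages kill every covering preimage (`coverPreimages_eq_empty_of_two_far`), and the column is
`2/5 + (#pairPre − 2)/25 ≤ 2/5 + 13/25 < 1` (`#pairPre ≤ #seriesPairs ≤ 15`).
-/

namespace PercRepro.Shadow

open Finset PerFlat ThmH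

variable {α : Type*} [DecidableEq α] {M : Matroid α} [M.Finite]

open scoped Classical in
/-- Under the two-closure hypothesis, `S` has at most two far preimages. -/
theorem card_opFarPre_le_two {G : Finset α}
    (htwo : ∃ F₁ F₂ : Finset α, ∀ B ∈ membersIn M (Uq M (4 + 2) 4) G, (G \ clF M B).card = 2 →
      clF M B = F₁ ∨ clF M B = F₂)
    (S : Finset α) : (opFarPre M G S).card ≤ 2 := by
  obtain ⟨F₁, F₂, hF⟩ := htwo
  -- a far preimage is determined by its closure: `B = S ∖ (G ∖ cl B)`
  have key : ∀ B ∈ opFarPre M G S, B = S \ (G \ clF M B) := by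
    intro B hB
    unfold opFarPre at hB
    rw [Finset.mem_filter] at hB
    obtain ⟨hBm, -, hBS⟩ := hB
    have hBU : B ∈ Uq M (4 + 2) 4 := (mem_membersIn.1 hBm).1
    rw [hBS, Finset.union_sdiff_right]
    symm
    rw [Finset.sdiff_eq_self_iff_disjoint, Finset.disjoint_left]
    intro e heB he
    exact (Finset.mem_sdiff.1 he).2 (subset_clF hBU heB)
  have himg : opFarPre M G S ⊆ ({S \ (G \ F₁), S \ (G \ F₂)} : Finset (Finset α)) := by
    intro B hB
    have hB' := hB
    unfold opFarPre at hB'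
    rw [Finset.mem_filter] at hB'
    obtain ⟨hBm, hB2, -⟩ := hB'
    rw [Finset.mem_insert, Finset.mem_singleton]
    rcases hF B hBm hB2 with h | h
    · left; rw [key B hB, h]
    · right; rw [key B hB, h]
  exact (Finset.card_le_card himg).trans (Finset.card_le_two)

open scoped Classical in
/-- Two distinct far preimages of `S` leave it no covering preimage (the members' far sets are `S`). -/
theorem coverPreimages_eq_empty_of_card_opFarPre {G : Finset α} (hG : G ∈ flatsQ M (4 + 1))
    (hd : (gr M \ G).card = 2) {S : Finset α} (h2 : 2 ≤ (opFarPre M G S).card) :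
    coverPreimages M (Uq M (4 + 2) 4) G S = ∅ := by
  obtain ⟨B₁, hB₁, B₂, hB₂, hne⟩ := Finset.one_lt_card.1 (by omega : 1 < (opFarPre M G S).card)
  unfold opFarPre at hB₁ hB₂
  rw [Finset.mem_filter] at hB₁ hB₂
  exact coverPreimages_eq_empty_of_two_far hG hd hB₁.1 hB₂.1 hB₁.2.1 hB₂.2.1 hB₁.2.2 hB₂.2.2 hne

/-- The arithmetic of the column with `f ≤ 2` far preimages: `c/5 + (P − f)/25 + f/5 ≤ 1` when `c ≤ a ≤ 5`,
`2P ≤ (6−a)(5−a)`, `f ≤ 2`, `f ≤ P`, and `f = 2 → c = 0`. -/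
theorem tp_col_arith {a c P f : ℕ} (ha : a ≤ 5) (hc : c ≤ a) (hP : 2 * P ≤ (4 + 2 - a) * (4 + 1 - a))
    (hf : f ≤ 2) (hfP : f ≤ P) (hf2 : f = 2 → c = 0) :
    (c : ℚ) * (1 / 5) + ((P : ℚ) - (f : ℚ)) * (1 / 25) + (f : ℚ) * (1 / 5) ≤ 1 := by
  have hnat : 5 * c + P + 4 * f ≤ 25 := by
    interval_cases f
    · interval_cases a <;> omega
    · interval_cases a <;> omega
    · have hc0 := hf2 rfl
      subst hc0
      interval_cases a <;> omega
  have hq : ((5 * c + P + 4 * f : ℕ) : ℚ) ≤ 25 := by exact_mod_cast hnat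
  push_cast at hq
  linarith

open scoped Classical in
/-- **The column bound** of the pair-5 rule under the two-closure hypothesis. -/
theorem sum_opW_col_le_two {G : Finset α} (hG : G ∈ flatsQ M (4 + 1)) (hd : (gr M \ G).card = 2)
    (htwo : ∃ F₁ F₂ : Finset α, ∀ B ∈ membersIn M (Uq M (4 + 2) 4) G, (G \ clF M B).card = 2 →
      clF M B = F₁ ∨ clF M B = F₂)
    {S : Finset α} (hS : S ∈ shadowAt M (4 + 2) 4 (Uq M (4 + 2) 4) G) :
    ∑ B ∈ membersIn M (Uq M (4 + 2) 4) G, opW M G B S ≤ 1 := by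
  have hGg : G ⊆ gr M := (mem_flatsQ.1 hG).1
  have hc : ∀ B ∈ membersIn M (Uq M (4 + 2) 4) G, (gr M \ clF M B).card = (G \ clF M B).card + 2 := by
    intro B hB
    rw [card_sdiff_clF_eq_add hGg (mem_membersIn.1 hB).2, hd]
  have hSG : S ⊆ G := subset_of_mem_shadowAt hS
  have hSE : S ⊆ gr M := hSG.trans hGg
  have hSY : S ∈ Yq M (4 + 2) 4 := shadow_subset_Yq _ (mem_shadowAt.1 hS).1
  have hSr : rkN M S = 4 + 1 := by
    unfold rkN; rw [eRk_eq_of_mem_Yq_diag hSY]; rfl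
  have hcol : (coloops M S).card ≤ 4 + 1 := card_coloops_le hSE (eRk_eq_of_mem_Yq_diag hSY)
  have hP := two_mul_card_seriesPairs_le hSE hSr
  have hpp := card_pairPre_le hG hS
  have hfar := card_opFarPre_le_two htwo S
  have hfp : (opFarPre M G S).card ≤ (pairPre M 4 G S).card :=
    Finset.card_le_card (opFarPre_subset_pairPre G S)
  have hcpre : (coverPreimages M (Uq M (4 + 2) 4) G S).card ≤ (coloops M S).card :=
    card_coverPreimages_le_card_coloops (le_refl _) G S
  have hf2 : (opFarPre M G S).card = 2 → (coverPreimages M (Uq M (4 + 2) 4) G S).card = 0 := by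
    intro h
    rw [coverPreimages_eq_empty_of_card_opFarPre hG hd (by omega)]
    rfl
  unfold opW
  rw [Finset.sum_add_distrib, Finset.sum_add_distrib, sum_opW_cov_col, sum_opFar_col]
  have hcov : ∑ B ∈ coverPreimages M (Uq M (4 + 2) 4) G S, opCov M G B ≤
      ((coverPreimages M (Uq M (4 + 2) 4) G S).card : ℚ) * (1 / 5) := by
    calc ∑ B ∈ coverPreimages M (Uq M (4 + 2) 4) G S, opCov M G B
        ≤ ∑ B ∈ coverPreimages M (Uq M (4 + 2) 4) G S, (1 / 5 : ℚ) := by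
          apply Finset.sum_le_sum
          intro B hB
          exact opCov_le (hc B (mem_coverPreimages.1 hB).1)
      _ = ((coverPreimages M (Uq M (4 + 2) 4) G S).card : ℚ) * (1 / 5) := by
          rw [Finset.sum_const, nsmul_eq_mul]
  have hpair := sum_opW_pair_col_le hc S
  have harith := tp_col_arith (a := (coloops M S).card) (c := (coverPreimages M (Uq M (4 + 2) 4) G S).card)
    (P := (pairPre M 4 G S).card) (f := (opFarPre M G S).card) hcol hcpre (by omega) hfar hfp hf2
  calc _ ≤ ((coverPreimages M (Uq M (4 + 2) 4) G S).card : ℚ) * (1 / 5) +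
      (((pairPre M 4 G S).card : ℚ) - ((opFarPre M G S).card : ℚ)) * (1 / 25) +
      ((opFarPre M G S).card : ℚ) * (1 / 5) := add_le_add (add_le_add hcov hpair) (le_refl _)
    _ ≤ 1 := harith

open scoped Classical in
/-- **The (6,4) cell `|E ∖ G| = 2` with at most two 2-cocircuit hyperplanes.**  `G ∈ flatsQ M 5`, `|E ∖ G| = 2`,
every member below `G` has `|G ∖ cl B| ≥ 2`, and the closures of the members with `|G ∖ cl B| = 2` take at most two
values ⟹ (LI_G). -/
theorem localShadowHall_d2_of_two_pair {G : Finset α} (hG : G ∈ flatsQ M (4 + 1))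
    (hd : (gr M \ G).card = 2)
    (hm2 : ∀ B ∈ membersIn M (Uq M (4 + 2) 4) G, 2 ≤ (G \ clF M B).card)
    (htwo : ∃ F₁ F₂ : Finset α, ∀ B ∈ membersIn M (Uq M (4 + 2) 4) G, (G \ clF M B).card = 2 →
      clF M B = F₁ ∨ clF M B = F₂) :
    LocalShadowHall M 4 G := by
  have hGg : G ⊆ gr M := (mem_flatsQ.1 hG).1
  have hc : ∀ B ∈ membersIn M (Uq M (4 + 2) 4) G, (gr M \ clF M B).card = (G \ clF M B).card + 2 := by
    intro B hB
    rw [card_sdiff_clF_eq_add hGg (mem_membersIn.1 hB).2, hd]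
  apply localShadowHall_of_full_matching (opW M G)
  · intro B S
    exact opW_nonneg G B S
  · intro B S h
    unfold opW at h
    by_cases h1 : (if B ∈ membersIn M (Uq M (4 + 2) 4) G ∧ S ∈ coverSets M B G then opCov M G B else 0) = 0
    · by_cases h2 : (if B ∈ membersIn M (Uq M (4 + 2) 4) G then
          ∑ P ∈ Finset.powersetCard 2 (G \ clF M B), (if S = B ∪ P then cpPair M 4 G B else 0) else 0) = 0
      · rw [h1, h2, zero_add, zero_add] at h
        split_ifs at h with hB
        · unfold opFar at h
          split_ifs at h with hf
          · rw [hf.2]; exact Finset.subset_union_left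
          · exact absurd rfl h
        · exact absurd rfl h
      · split_ifs at h2 with hB
        · obtain ⟨P, hP, hne⟩ := Finset.exists_ne_zero_of_sum_ne_zero h2
          split_ifs at hne with hSP
          · rw [hSP]; exact Finset.subset_union_left
          · exact absurd rfl hne
        · exact absurd rfl h2
    · split_ifs at h1 with hcv
      · obtain ⟨z, -, rfl⟩ := mem_coverSets.1 hcv.2
        exact Finset.subset_insert _ _
      · exact absurd rfl h1
  · intro S hS
    exact sum_opW_col_le_two hG hd htwo hS
  · intro B hB
    exact row_opW_ge hG hB (hc B hB) (hm2 B hB)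

end PercRepro.Shadow
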